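import Summits.ResolutionOfSingularities.ResolutionOfSingularities.Theorems.HilbertSamuelEliminationSigmaMaxModificationsCorridor3Directrix214SharpNearFibre
import Summits.ResolutionOfSingularities.ResolutionOfSingularities.Theorems.HilbertSamuelEliminationCampaignW42ThmIVOfSeparable
import Summits.ResolutionOfSingularities.ResolutionOfSingularities.Theorems.HilbertSamuelEliminationCampaignW42Thm314Pointwise
import Summits.ResolutionOfSingularities.KangarooAtlas.MizutaniVectorGroupHolds
import Literature.AlgebraicGeometry.Resolution.Hironaka1970NearPointNormalConePoint
import HarnessLib

/-!
# [OURS · L1 W4.2] CJS Thm. 3.14 for POINT centres in LOCUS form (`x' ∈ ℙ(Dir_x(X))`) POINTWISE from Theorem IV at the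
# point — hence, with NO named fact, at every near point with SEPARABLE ALGEBRAIC residue field extension over an arbitrary
# `κ(x)` (under (F1♯) `GeomDirHypothesis`); Th. IV (point centre) at perfect / separable points (campaign s42, cell res-hironaka; `--supports` stmt-ResolutionOfSingularities-17845)

HONEST FRAMING. OURS (slot W4.2, prover res-L1-s42-pv-1, gen 7). The point-centre companions of `…CampaignW42Thm314Pointwise`:

* **`tangentConeIdeal_le_span_inter_multAlgebra_of_perfectField`** — [H4] THEOREM IV for the blow-up of a CLOSED POINT `x`
  with PERFECT `κ(x)` (the body of F-51 `Hironaka1970_thmIV_point` at such a point: the tangent-cone ideal `J` is generated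
  inside `U(𝔭_{x'})` at every near `x'`), from `normalConeIdeal_le_span_inter_multAlgebra_of_perfectField` exactly as the tree's
  `Hironaka1970_thmIV_point_of_thmIV` (`I_{{x},x} = 𝔪_x`, `J_D = J`);
* **`isOnProjDirectrix_of_thmIVPointAt`** — stub-3's `Directrix214Sharp.thm314_point_locus_geomDir_of_thmIV_point` (both
  branches: characteristic `0` via `directrixSpace_le_prime_of_charZero`, positive characteristic via res-type-001's T7
  `directrix_nearPoint_of_geomDirDim_le` with F-52/F-50b PROVED) re-run VERBATIM with the global fact F-51 replaced by THEOREM IV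
  AT THE POINT `x'` (hypothesis `hIV`); of the near-point hypothesis nothing else is used;
* **`tangentConeIdeal_le_span_inter_multAlgebra_of_isSeparable`**, **`isOnProjDirectrix_of_near_of_isSeparable`**,
  `mem_projDirectrixFibre_of_near_of_isSeparable` — the same at near points `x'` with SEPARABLE ALGEBRAIC `κ(x')/κ(x)` over an
  ARBITRARY (possibly imperfect) `κ(x)`: Th. IV (point centre) and `x' ∈ ℙ(Dir_x(X))` under (F1♯), NO named fact — the new
  content (at perfect `κ(x)` the tree's gen-3 `isOnProjDirectrix_of_near_of_perfectField` is stronger, with no characteristic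
  clause, since there `U(𝔭)` is linear);
* **`dim_lt_dirDim_of_near_of_isSeparable`** — CJS Thm. 3.14 numerical (general permissible centre, printed `CharHypothesis`)
  at near points with separable algebraic residue field extension, NO named fact.

NOT a statement of H. Hironaka's manuscript [Hironaka2017]; the statements proved are CJS's Thm. 3.14 (point centre, locus
form) at the given point. Credits for the copied chart argument: res-type-001 (T7), res-L1-w42-stub-3, res-D-lib-1.
AI-written; AI review is weaker than expert review.
-/

set_option linter.dupNamespace false

noncomputable section

open CategoryTheory AlgebraicGeometry TopologicalSpace IsLocalRing MvPolynomial
open Literature.AlgebraicGeometry.Resolution Literature.AlgebraicGeometry.Resolution.HironakaScheme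
open Literature.RingTheory.HilbertSamuel Literature.RingTheory.MvPolynomial
open Literature.AlgebraicGeometry.CossartJannsenSaito2020
open Summit.ResolutionOfSingularities.KangarooAtlas.Mizutani
open Summit.ResolutionOfSingularities.ResolutionOfSingularities.Theorems.SigmaMaxModificationsCorridor3.Directrix214Sharp

namespace Summit.ResolutionOfSingularities.ResolutionOfSingularities.Theorems

namespace CampaignW42

universe u

section PointCentre

variable {X X' : Scheme.{u}} [IsLocallyNoetherian X]

/-- **[H4] THEOREM IV for the blow-up of a closed point `x` with PERFECT residue field** (F-51 `Hironaka1970_thmIV_point`'s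
body at such a point): `X` excellent, `{x}` permissible, `π` the blow-up in `{x}`, `x'` near to `x` at level `N`; for every
system of generators `g` of `𝔪_x` and every chart datum `(t, u)` at `x'`, the tangent-cone ideal `J` is generated by its
elements in `U(𝔭_{x'})`. [cite: Hironaka1970NumericalCharacters, THEOREM IV p. 156 L11–12; p. 170 L3–9 (14.3)] -/
theorem tangentConeIdeal_le_span_inter_multAlgebra_of_perfectField (π : X' ⟶ X) (x : X) (hx : IsClosed ({x} : Set X))
    (N : ℕ) (x' : X') (hexc : Scheme.IsExcellent X)
    (hperm : IdealSheafData.IsPermissible (Scheme.IdealSheafData.vanishingIdeal ⟨{x}, hx⟩))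
    (hπ : IsBlowup π (Scheme.IdealSheafData.vanishingIdeal ⟨{x}, hx⟩)) (hxx' : π.base x' = x)
    (hnear : Scheme.hsFun X' N x' = Scheme.hsFun X N x)
    (hperf : PerfectField (ResidueField (X.presheaf.stalk (π.base x'))))
    {e : ℕ} (g : Fin e → X.presheaf.stalk (π.base x'))
    (hg : Ideal.span (Set.range g) = maximalIdeal (X.presheaf.stalk (π.base x')))
    (t : X'.presheaf.stalk x') (u : Fin e → X'.presheaf.stalk x')
    (ht : t ∈ nonZeroDivisors (X'.presheaf.stalk x'))
    (hmap : (maximalIdeal (X.presheaf.stalk (π.base x'))).map (π.stalkMap x').hom = Ideal.span {t})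
    (hu : ∀ i, (π.stalkMap x').hom (g i) = u i * t) :
    tangentConeIdeal g hg ≤ Ideal.span
      ((tangentConeIdeal g hg : Set (MvPolynomial (Fin e) (ResidueField (X.presheaf.stalk (π.base x'))))) ∩
        (multAlgebra (ResidueField (X.presheaf.stalk (π.base x'))) (chartPrime (π.stalkMap x').hom u) :
          Set (MvPolynomial (Fin e) (ResidueField (X.presheaf.stalk (π.base x')))))) := by
  subst hxx'
  set D : X.IdealSheafData := Scheme.IdealSheafData.vanishingIdeal ⟨{π.base x'}, hx⟩ with hD
  have hxD : π.base x' ∈ (D.support : Set X) := by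
    rw [hD, Scheme.IdealSheafData.coe_support_vanishingIdeal]
    exact Set.mem_singleton _
  have hstalk : stalkIdeal D (π.base x') = maximalIdeal (X.presheaf.stalk (π.base x')) :=
    stalkIdeal_vanishingIdeal_singleton hx
  have hgD : Ideal.span (Set.range g) = stalkIdeal D (π.base x') := hg.trans hstalk.symm
  have hmapD : (stalkIdeal D (π.base x')).map (π.stalkMap x').hom = Ideal.span {t} := by rw [hstalk]; exact hmap
  have h' := normalConeIdeal_le_span_inter_multAlgebra_of_perfectField hπ x' (hperm _ hxD)
    (hexc.isUniversallyCatenaryRing_stalk _) hnear g hgD t ht hmapD u hu hperf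
  rwa [normalConeIdeal_eq_tangentConeIdeal g hg] at h'

/-- **CJS Thm. 3.14, point centre, locus form, AT A POINT, from THE CONCLUSION OF THEOREM IV AT THAT POINT**: `π` the
blow-up of `X` in a closed point `x`, `x'` over `x`, (F1♯) `char κ(x) = 0 ∨ ē_x(X) + 2 ≤ 2·char κ(x)`; if Th. IV's conclusion
holds at `x'` for every minimal system of generators of `𝔪_x` and every chart datum (`hIV`), then `x' ∈ ℙ(Dir_x(X))`
(`IsOnProjDirectrix π x'`). The chart argument of `thm314_point_locus_geomDir_of_thmIV_point` /
`directrix_nearPoint_of_geomDirDim_le`, copied with `h14 …` replaced by `hIV`. [cite: CossartJannsenSaito2020, Thm. 3.14 and its proof p. 51–52]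
[cite: Hironaka1970NumericalCharacters, (13.1) p. 168] -/
theorem isOnProjDirectrix_of_thmIVPointAt (π : X' ⟶ X) (x : X) (hx : IsClosed ({x} : Set X)) (x' : X')
    (hπ : IsBlowup π (Scheme.IdealSheafData.vanishingIdeal ⟨{x}, hx⟩)) (hxx' : π.base x' = x)
    (hgeo : SigmaMaxModificationsCorridor3.Moving.GeomDirHypothesis X x)
    (hIV : ∀ (e : ℕ) (g : Fin e → X.presheaf.stalk (π.base x'))
      (hg : Ideal.span (Set.range g) = maximalIdeal (X.presheaf.stalk (π.base x')))
      (t : X'.presheaf.stalk x') (u : Fin e → X'.presheaf.stalk x'),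
      (maximalIdeal (X.presheaf.stalk (π.base x'))).spanFinrank = e →
      t ∈ nonZeroDivisors (X'.presheaf.stalk x') →
      (maximalIdeal (X.presheaf.stalk (π.base x'))).map (π.stalkMap x').hom = Ideal.span {t} →
      (∀ i, (π.stalkMap x').hom (g i) = u i * t) →
        tangentConeIdeal g hg ≤ Ideal.span
          ((tangentConeIdeal g hg : Set (MvPolynomial (Fin e) (ResidueField (X.presheaf.stalk (π.base x'))))) ∩
            (multAlgebra (ResidueField (X.presheaf.stalk (π.base x'))) (chartPrime (π.stalkMap x').hom u) :
              Set (MvPolynomial (Fin e) (ResidueField (X.presheaf.stalk (π.base x'))))))) :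
    IsOnProjDirectrix π x' := by
  subst hxx'
  set A := X.presheaf.stalk (π.base x') with hA
  set B := X'.presheaf.stalk x' with hB
  set φ : A →+* B := (π.stalkMap x').hom with hφ
  haveI : IsLocalHom φ := π.toLRSHom.prop x'
  set K := ResidueField A with hK
  -- the chart of the exceptional divisor at `x'`
  obtain ⟨t, ht, hspan⟩ := hπ.isEffectiveCartier.exists_stalkIdeal_eq_span x'
  have hmap : (maximalIdeal A).map φ = Ideal.span {t} := by
    rw [← hspan, stalkIdeal_comap_eq_map_stalkMap, stalkIdeal_vanishingIdeal_singleton hx]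
  -- embedding dimension
  rcases Nat.eq_zero_or_pos (maximalIdeal A).spanFinrank with he0 | hepos
  · -- `emb.dim = 0`: no linear forms, the condition is vacuous
    intro L hL c hc
    have hempty : IsEmpty (Fin (maximalIdeal A).spanFinrank) := ⟨fun i => Fin.elim0 (Fin.cast he0 i)⟩
    rw [Finset.univ_eq_empty, Finset.sum_empty, map_zero]
    exact Ideal.zero_mem _
  obtain ⟨n, hn⟩ : ∃ n, (maximalIdeal A).spanFinrank = n + 1 := ⟨_, (Nat.succ_pred_eq_of_pos hepos).symm⟩
  -- the re-indexed minimal generators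
  set g : Fin (n + 1) → A := minGenerators A ∘ Fin.cast hn.symm with hg
  have hgspan : Ideal.span (Set.range g) = maximalIdeal A := by
    have hsurj : Function.Surjective (Fin.cast hn.symm) := fun i => ⟨Fin.cast hn i, by simp⟩
    rw [hg, hsurj.range_comp]
    exact span_range_minGenerators A
  -- `π^♯(g_i) = u_i t`
  have hu : ∀ i, ∃ ui : B, φ (g i) = ui * t := by
    intro i
    have hmem : φ (g i) ∈ (maximalIdeal A).map φ := by
      refine Ideal.mem_map_of_mem φ ?_
      rw [← hgspan]
      exact Ideal.subset_span ⟨i, rfl⟩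
    rw [hmap, Ideal.mem_span_singleton'] at hmem
    obtain ⟨ui, hui⟩ := hmem
    exact ⟨ui, hui.symm⟩
  choose u hu using hu
  -- THEOREM IV at the point: the tangent-cone ideal is generated inside `U(𝔭_{x'})`
  set J := tangentConeIdeal g hgspan with hJ
  set 𝔭 := chartPrime φ u with h𝔭
  have h14' := hIV (n + 1) g hgspan t u hn ht hmap hu
  -- `𝔭_{x'}` is a point of `ℙ(T_x X)`
  haveI : 𝔭.IsPrime := isPrime_chartPrime φ u
  have hpt : IsPoint K 𝔭 := by
    refine ⟨isPrime_chartPrime φ u, fun f hf d => homogeneousComponent_mem_chartPrime φ u hf d, ?_⟩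
    obtain ⟨i, hi⟩ := exists_X_not_mem_chartPrime φ hgspan ht hmap hu
    intro hle
    exact hi (hle (by simp [irrelevant]))
  -- the core, by characteristic: `𝒯(J) ⊆ 𝔭_{x'}`
  have hcore : ∀ L ∈ directrixSpace J, L ∈ 𝔭 := by
    rcases Nat.eq_zero_or_pos (ringChar K) with hc0 | hpos
    · -- characteristic `0`: `U(𝔭)` is generated by linear forms
      haveI : CharP K 0 := hc0 ▸ ringChar.charP K
      haveI : CharZero K := CharP.charP_to_charZero K
      exact fun L hL => directrixSpace_le_prime_of_charZero h14' hL
    · -- positive characteristic: Mizutani's bound from `ē_x(X) + 2 ≤ 2p`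
      have hgeom : Scheme.geomDirDim X (π.base x') + 2 ≤ 2 * ringChar K := by
        rcases hgeo with h0 | hle
        · exact absurd h0 hpos.ne'
        · exact hle
      set p := ringChar K with hp
      haveI : CharP K p := ringChar.charP K
      haveI hpp : Fact p.Prime := ⟨CharP.char_prime_of_ne_zero K (Nat.pos_iff_ne_zero.mp hpos)⟩
      set Kbar := AlgebraicClosure K with hKbar
      haveI : PerfectRing Kbar p := PerfectField.toPerfectRing p
      have hdir : directrixDim (J.map (MvPolynomial.map (algebraMap K Kbar))) + 2 ≤ 2 * p := by
        have hgeom' : directrixDim (((canonicalTangentConeIdeal A)).map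
            (MvPolynomial.map (algebraMap K Kbar))) + 2 ≤ 2 * p := hgeom
        rwa [← directrixDim_map_tangentConeIdeal_comp_cast (algebraMap K Kbar) hn.symm
          (span_range_minGenerators A) hgspan] at hgeom'
      exact fun L hL => directrixSpace_le_prime_of_facts p Kbar (Hironaka1970_thm1_cor_holds p)
        (mizutani1973_vectorGroup_of_dim_le_of_hironaka p (Hironaka1970_thm1_cor_holds p)) hpt h14' hdir hL
  -- the chart dictionary, and re-indexing of the minimal generators
  have hlift : ProjDirLiftsInto φ g hgspan :=
    (projDirLiftsInto_iff_directrixSpace_le_chartPrime φ hgspan ht hmap hu).mpr hcore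
  exact (projDirLiftsInto_comp_cast_iff φ hn.symm (span_range_minGenerators A) hgspan).mp hlift

/-- **[H4] THEOREM IV for the blow-up of a closed point `x`, at a near point `x'` with SEPARABLE ALGEBRAIC `κ(x')/κ(x)`**
(F-51 `Hironaka1970_thmIV_point`'s body at such a point), from `normalConeIdeal_le_span_inter_multAlgebra_of_isSeparable`.
[cite: Hironaka1970NumericalCharacters, THEOREM IV p. 156 L11–12; p. 170 L3–9 (14.3)] -/
theorem tangentConeIdeal_le_span_inter_multAlgebra_of_isSeparable (π : X' ⟶ X) (x : X) (hx : IsClosed ({x} : Set X))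
    (N : ℕ) (x' : X') (hexc : Scheme.IsExcellent X)
    (hperm : IdealSheafData.IsPermissible (Scheme.IdealSheafData.vanishingIdeal ⟨{x}, hx⟩))
    (hπ : IsBlowup π (Scheme.IdealSheafData.vanishingIdeal ⟨{x}, hx⟩)) (hxx' : π.base x' = x)
    (hnear : Scheme.hsFun X' N x' = Scheme.hsFun X N x)
    (hsep : letI : Algebra (ResidueField (X.presheaf.stalk (π.base x'))) (ResidueField (X'.presheaf.stalk x')) :=
        (ResidueField.map (π.stalkMap x').hom).toAlgebra;
      Algebra.IsSeparable (ResidueField (X.presheaf.stalk (π.base x'))) (ResidueField (X'.presheaf.stalk x')))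
    {e : ℕ} (g : Fin e → X.presheaf.stalk (π.base x'))
    (hg : Ideal.span (Set.range g) = maximalIdeal (X.presheaf.stalk (π.base x')))
    (t : X'.presheaf.stalk x') (u : Fin e → X'.presheaf.stalk x')
    (ht : t ∈ nonZeroDivisors (X'.presheaf.stalk x'))
    (hmap : (maximalIdeal (X.presheaf.stalk (π.base x'))).map (π.stalkMap x').hom = Ideal.span {t})
    (hu : ∀ i, (π.stalkMap x').hom (g i) = u i * t) :
    tangentConeIdeal g hg ≤ Ideal.span
      ((tangentConeIdeal g hg : Set (MvPolynomial (Fin e) (ResidueField (X.presheaf.stalk (π.base x'))))) ∩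
        (multAlgebra (ResidueField (X.presheaf.stalk (π.base x'))) (chartPrime (π.stalkMap x').hom u) :
          Set (MvPolynomial (Fin e) (ResidueField (X.presheaf.stalk (π.base x')))))) := by
  subst hxx'
  set D : X.IdealSheafData := Scheme.IdealSheafData.vanishingIdeal ⟨{π.base x'}, hx⟩ with hD
  have hxD : π.base x' ∈ (D.support : Set X) := by
    rw [hD, Scheme.IdealSheafData.coe_support_vanishingIdeal]
    exact Set.mem_singleton _
  have hstalk : stalkIdeal D (π.base x') = maximalIdeal (X.presheaf.stalk (π.base x')) :=
    stalkIdeal_vanishingIdeal_singleton hx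
  have hgD : Ideal.span (Set.range g) = stalkIdeal D (π.base x') := hg.trans hstalk.symm
  have hmapD : (stalkIdeal D (π.base x')).map (π.stalkMap x').hom = Ideal.span {t} := by rw [hstalk]; exact hmap
  have h' := normalConeIdeal_le_span_inter_multAlgebra_of_isSeparable hπ x' (hperm _ hxD)
    (hexc.isUniversallyCatenaryRing_stalk _) hnear g hgD t ht hmapD u hu hsep
  rwa [normalConeIdeal_eq_tangentConeIdeal g hg] at h'

/-- **CJS Thm. 3.14 (point centre, locus form) at every near point `x'` with SEPARABLE ALGEBRAIC residue field extension
`κ(x')/κ(x)` — every characteristic, `κ(x)` arbitrary, no named fact**: `X` excellent, `{x}` permissible, `π` the blow-up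
in `{x}`, `x'` near to `x` at level `N` with `κ(x')` separable algebraic over `κ(x)`, and
`char κ(x) = 0 ∨ ē_x(X) + 2 ≤ 2·char κ(x)` ⇒ `x' ∈ ℙ(Dir_x(X))`. (At perfect `κ(x)` the tree already has the stronger
`isOnProjDirectrix_of_near_of_perfectField`, gen 3, with no characteristic clause; the content here is the IMPERFECT
`κ(x)` / separable `κ(x')` case, where `U(𝔭_{x'})` need not be linear and Mizutani's bound is used.)
[cite: CossartJannsenSaito2020, Thm. 3.14] -/
theorem isOnProjDirectrix_of_near_of_isSeparable (π : X' ⟶ X) (x : X) (hx : IsClosed ({x} : Set X)) (N : ℕ) (x' : X')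
    (hexc : Scheme.IsExcellent X)
    (hperm : IdealSheafData.IsPermissible (Scheme.IdealSheafData.vanishingIdeal ⟨{x}, hx⟩))
    (hπ : IsBlowup π (Scheme.IdealSheafData.vanishingIdeal ⟨{x}, hx⟩)) (hxx' : π.base x' = x)
    (hgeo : SigmaMaxModificationsCorridor3.Moving.GeomDirHypothesis X x)
    (hnear : Scheme.hsFun X' N x' = Scheme.hsFun X N x)
    (hsep : letI : Algebra (ResidueField (X.presheaf.stalk (π.base x'))) (ResidueField (X'.presheaf.stalk x')) :=
        (ResidueField.map (π.stalkMap x').hom).toAlgebra;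
      Algebra.IsSeparable (ResidueField (X.presheaf.stalk (π.base x'))) (ResidueField (X'.presheaf.stalk x'))) :
    IsOnProjDirectrix π x' := by
  refine isOnProjDirectrix_of_thmIVPointAt π x hx x' hπ hxx' hgeo ?_
  intro e g hg t u _he ht hmap hu
  subst hxx'
  exact tangentConeIdeal_le_span_inter_multAlgebra_of_isSeparable π (π.base x') hx N x' hexc hperm hπ rfl hnear hsep
    g hg t u ht hmap hu

/-- The same in the consumers' locus vocabulary: `x' ∈ projDirectrixFibre π x`. [cite: CossartJannsenSaito2020, Thm. 3.14] -/
theorem mem_projDirectrixFibre_of_near_of_isSeparable (π : X' ⟶ X) (x : X) (hx : IsClosed ({x} : Set X)) (N : ℕ)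
    (x' : X') (hexc : Scheme.IsExcellent X)
    (hperm : IdealSheafData.IsPermissible (Scheme.IdealSheafData.vanishingIdeal ⟨{x}, hx⟩))
    (hπ : IsBlowup π (Scheme.IdealSheafData.vanishingIdeal ⟨{x}, hx⟩)) (hxx' : π.base x' = x)
    (hgeo : SigmaMaxModificationsCorridor3.Moving.GeomDirHypothesis X x)
    (hnear : Scheme.hsFun X' N x' = Scheme.hsFun X N x)
    (hsep : letI : Algebra (ResidueField (X.presheaf.stalk (π.base x'))) (ResidueField (X'.presheaf.stalk x')) :=
        (ResidueField.map (π.stalkMap x').hom).toAlgebra;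
      Algebra.IsSeparable (ResidueField (X.presheaf.stalk (π.base x'))) (ResidueField (X'.presheaf.stalk x'))) :
    x' ∈ projDirectrixFibre π x :=
  ⟨hxx', isOnProjDirectrix_of_near_of_isSeparable π x hx N x' hexc hperm hπ hxx' hgeo hnear hsep⟩

/-- **CJS Thm. 3.14 (numerical form, general permissible centre) at every near point `x'` with separable algebraic
`κ(x')/κ(x)`, under the printed `CharHypothesis X x` — no named fact.** [cite: CossartJannsenSaito2020, Thm. 3.14] -/
theorem dim_lt_dirDim_of_near_of_isSeparable (π : X' ⟶ X) (D : X.IdealSheafData) (hexc : Scheme.IsExcellent X)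
    (hperm : IdealSheafData.IsPermissible D) (hπ : IsBlowup π D) (N : ℕ)
    (x' : X') (hxD : π.base x' ∈ D.support) (hCH : CharHypothesis X (π.base x'))
    (hnear : Scheme.hsFun X' N x' = Scheme.hsFun X N (π.base x'))
    (hsep : letI : Algebra (ResidueField (X.presheaf.stalk (π.base x'))) (ResidueField (X'.presheaf.stalk x')) :=
        (ResidueField.map (π.stalkMap x').hom).toAlgebra;
      Algebra.IsSeparable (ResidueField (X.presheaf.stalk (π.base x'))) (ResidueField (X'.presheaf.stalk x'))) :
    ringKrullDim (X.presheaf.stalk (π.base x') ⧸ stalkIdeal D (π.base x')) <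
      (Scheme.dirDim X (π.base x') : WithBot ℕ∞) :=
  dim_lt_dirDim_of_thmIVAt π D hperm hπ x' hxD hCH
    fun _m g t u hgI _hm ht hmap hu =>
      normalConeIdeal_le_span_inter_multAlgebra_of_isSeparable hπ x' (hperm _ hxD)
        (hexc.isUniversallyCatenaryRing_stalk _) hnear g hgI t ht hmap u hu hsep

end PointCentre

end CampaignW42

end Summit.ResolutionOfSingularities.ResolutionOfSingularities.Theorems

end
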